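import Literature.NumberTheory.Automorphic.UnitaryGroupFormTransport        -- ★ `formCongr`, `unitaryGroupOfFormCongrOfEq` (the generic congruence iso `U(σ, H′) ≃ₜ* U(σ, H)`)
import Literature.NumberTheory.Automorphic.UnitaryGroupArchimedeanPlaces     -- ★ `UnitaryGroup.arch`, `archFormOf`, `conjMixed_mixedEmbedding`, `rationalToArch`
import Literature.NumberTheory.Automorphic.AdelicUnitaryGroup                -- ★ `cmConjRingHom`, `embedding_cmConjRingHom`, `hermForm`
import Mathlib.LinearAlgebra.Matrix.PosDef
import HarnessLib

/-!
# The archimedean congruence transport `U(c(P)ᵀ H P)(L⁺ ⊗ ℝ) ≃ₜ* U(H)(L⁺ ⊗ ℝ)` and the transport of the (S-d) guards (ROAD-Sd (T-d)(a)+(e))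

Topic `NumberTheory/Automorphic`; namespaces `Literature.NumberTheory.Automorphic` (§1, generic) and `…Automorphic.UnitaryGroup` (§2–§3, CM field).
THEOREMS ONLY (no `def`, no instance, no notation, no axiom, no `sorry`).  Cell `pub/hodgecm-mathlib`, ENGINE T1 (crux H413 = `stmt-HodgeConjecture-24833`);
floor-1 preparation, count-neutral, under books row #111 (S-d) (ROAD-Sd §3′ «congruence invariance»: the thirteen-conjunct (S-d) letter is stated for an
ARBITRARY non-degenerate `c`-hermitian `H`, while the torus stack ★ `ArchDiagonalTorus…`, `ArchTorusOrbitalFunction…`, `ArchTorusWeylAction` lives on the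
DIAGONAL form `diag α`; every `H` is congruent to a diagonal one, `H = c(P)ᵀ diag(α) P`, and this file supplies the two S–M-sized reusable pieces of the
transport along such a congruence — (a) the isomorphism of archimedean groups and (e) the transport of the guards `hherm`/`hanis`/`hS₀`/central scalars);
author F0P3a-p06 (g9) (LEAD DESK WORD T7-5 (9)).

WHAT IS PROVED.
* §1 (any commutative ring `R`, `σ : R →+* R`, `P ∈ GL_n(R)`; ★ `formCongr σ P H = σ(P)ᵀ H P`): `transpose_map_formCongr` (σ involutive ⇒ `formCongr` preserves
  `σ`-hermitian-ness), `hermForm_formCongr_apply` (`⟨x,y⟩_{σ(P)ᵀHP} = ⟨Px,Py⟩_H` for ★ `hermForm`), `anisotropic_formCongr`, `conj_smul_one_eq` (`P (ζ•1) P⁻¹ = ζ•1`).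
* §2 (CM field `L`, `c` = ★ `cmConjRingHom L`): **`archFormOf_formCongr`** — `archFormOf (c(P)ᵀ H P) = formCongr conjMixed (P ⊗ 1) (archFormOf H)` (★
  `conjMixed_mixedEmbedding` entrywise).  CONSEQUENTLY the arch congruence iso is the EXISTING generic term
  `unitaryGroupOfFormCongrOfEq (conjMixed L⁺ L c) (GL.map (mixedEmbedding L) P) (archFormOf L N H) _ (archFormOf_formCongr L P H).symm :
  arch L⁺ L c N (formCongr c P H) ≃ₜ* arch L⁺ L c N H` (★ `UnitaryGroupFormTransport`) — NO new definition is introduced; `coe_archCongr_apply` /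
  `coe_archCongr_symm_apply` record its action `g ↦ (P ⊗ 1) g (P ⊗ 1)⁻¹` (both `rfl`), `map_mixedEmbedding_conj` that it carries rational points `γ ⊗ 1`
  (★ `rationalToArch`) to `(PγP⁻¹) ⊗ 1`, and `map_mixedEmbedding_conj_of_smul_one` that CENTRAL rational scalars `ζ•1` are FIXED.
* §3 the guards of the (S-d) letter transport along `H ↦ c(P)ᵀ H P`: `transpose_map_formCongr_cm` (`hherm`), `anisotropic_formCongr_cm` (`hanis`),
  `map_embedding_formCongr_cm` (`τ(c(P)ᵀHP) = (τP)ᴴ (τH) (τP)` at a complex embedding `τ`, ★ `embedding_cmConjRingHom`), `posDef_map_formCongr_cm` and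
  `exists_posDef_formCongr_cm` (`hS₀`: a definite complex place stays definite — Mathlib `Matrix.PosDef.conjTranspose_mul_mul_same`).
NOT HERE (deferred by the LEAD desk, memo `ROAD-Sd-3prime-congruence`): the transport of the Haar/orbital/measure data of the (S-d) letter (sized L).
HONEST LABEL: HC_CM is proved only modulo the printed citations until rung 0 closes; this file is linear algebra and pays nothing by itself.

## References
* [PlatonovRapinchuk1994] V. Platonov, A. Rapinchuk, *Algebraic Groups and Number Theory*, Academic Press (1994), §2.3 (unitary groups of hermitian forms;
  equivalent forms give conjugate, isomorphic unitary groups).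
* [Rogawski1990] J. D. Rogawski, *Automorphic Representations of Unitary Groups in Three Variables*, Ann. of Math. Stud. 123 (1990), §14.1 p. 232 (the
  unitary groups `U(H)` of the CM extension and their signatures at ∞), §14.5 p. 239 (central elements).
* [BorelJacquet1979] A. Borel, H. Jacquet, *Automorphic forms and automorphic representations*, PSPM 33.1 (1979), §4.1 (`G_∞ = G(F ⊗ ℝ)`, rational points).
-/

set_option autoImplicit false

noncomputable section

open NumberField NumberField.InfinitePlace NumberField.mixedEmbedding
open Literature.AlgebraicGeometry.ShimuraVarieties (hermForm)
open scoped Matrix MatrixGroups ComplexOrder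

namespace Literature.NumberTheory.Automorphic

/-! ## §1 Generic: a congruence `H ↦ σ(P)ᵀ H P` preserves `σ`-hermitian-ness and anisotropy (any commutative ring, `σ` involutive) -/

section Generic

variable {R : Type*} [CommRing R] {n : Type*} [Fintype n] [DecidableEq n] (σ : R →+* R)

/-- `formCongr` PRESERVES `σ`-HERMITIAN-NESS (for an involutive `σ`): `(σ H)ᵀ = H → (σ (σ(P)ᵀ H P))ᵀ = σ(P)ᵀ H P`. [cite: PlatonovRapinchuk1994, §2.3] -/
theorem transpose_map_formCongr (hσ : ∀ x, σ (σ x) = x) (P : GL n R) {H : Matrix n n R} (hH : (H.map σ)ᵀ = H) :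
    ((formCongr σ P H).map σ)ᵀ = formCongr σ P H := by
  have hPP : ((P : Matrix n n R).map σ).map σ = (P : Matrix n n R) := by
    ext i j; simp [hσ]
  have hPt : (((P : Matrix n n R).map σ)ᵀ).map σ = (P : Matrix n n R)ᵀ := by
    rw [Matrix.transpose_map, hPP]
  rw [formCongr, Matrix.map_mul, Matrix.map_mul, hPt, Matrix.transpose_mul, Matrix.transpose_mul, Matrix.transpose_transpose, hH,
    Matrix.mul_assoc]

/-- `⟨x, y⟩_{σ(P)ᵀ H P} = ⟨P x, P y⟩_H` for the tree's `hermForm σ`. [cite: PlatonovRapinchuk1994, §2.3] -/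
theorem hermForm_formCongr_apply (P : GL n R) (H : Matrix n n R) (x y : n → R) :
    hermForm σ (formCongr σ P H) x y = hermForm σ H ((P : Matrix n n R) *ᵥ x) ((P : Matrix n n R) *ᵥ y) := by
  unfold hermForm
  rw [formCongr]
  have h1 : (σ ∘ ((P : Matrix n n R) *ᵥ x)) = ((P : Matrix n n R).map σ) *ᵥ (σ ∘ x) := by
    funext i; exact RingHom.map_mulVec σ _ x i
  rw [h1, ← Matrix.mulVec_mulVec, ← Matrix.mulVec_mulVec, Matrix.dotProduct_mulVec, Matrix.vecMul_transpose]

/-- `formCongr` PRESERVES ANISOTROPY. [cite: PlatonovRapinchuk1994, §2.3] -/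
theorem anisotropic_formCongr (P : GL n R) {H : Matrix n n R} (hH : ∀ x : n → R, hermForm σ H x x = 0 → x = 0) :
    ∀ x : n → R, hermForm σ (formCongr σ P H) x x = 0 → x = 0 := by
  intro x hx
  rw [hermForm_formCongr_apply] at hx
  have h := hH _ hx
  have h2 : ((P⁻¹ : GL n R) : Matrix n n R) *ᵥ ((P : Matrix n n R) *ᵥ x) = x := by
    rw [Matrix.mulVec_mulVec, ← Units.val_mul, inv_mul_cancel, Units.val_one, Matrix.one_mulVec]
  rw [← h2, h, Matrix.mulVec_zero]

/-- Scalars are FIXED by every congruence-conjugation: `P (ζ•1) P⁻¹ = ζ•1` in `GL_n(R)`. [cite: PlatonovRapinchuk1994, §2.3] -/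
theorem conj_smul_one_eq (P : GL n R) {g : GL n R} {ζ : R} (hg : (g : Matrix n n R) = ζ • (1 : Matrix n n R)) :
    P * g * P⁻¹ = g := by
  apply Units.ext
  rw [Units.val_mul, Units.val_mul, hg, Matrix.mul_smul, Matrix.mul_one, Matrix.smul_mul, ← Units.val_mul, mul_inv_cancel, Units.val_one]

end Generic

/-! ## §2 The archimedean congruence transport on `U(H)(L⁺ ⊗ ℝ)` (CM field `L`) -/

namespace UnitaryGroup

section CM

variable (L : Type) [Field L] [NumberField L] [IsCMField L] {N : ℕ}

/-- **THE ONE MISSING IDENTITY**: `archFormOf (c(P)ᵀ H P) = (c ⊗ 1)(P ⊗ 1)ᵀ · archFormOf H · (P ⊗ 1)` — the archimedean form of a congruent matrix is the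
congruent archimedean form (★ `conjMixed_mixedEmbedding` entrywise).  With it the arch congruence iso is the generic ★ `unitaryGroupOfFormCongrOfEq`.
[cite: PlatonovRapinchuk1994, §2.3] [cite: BorelJacquet1979, §4.1] -/
theorem archFormOf_formCongr (P : GL (Fin N) L) (H : Matrix (Fin N) (Fin N) L) :
    archFormOf L N (formCongr (cmConjRingHom L) P H) =
      formCongr (conjMixed (↥(maximalRealSubfield L)) L (IsCMField.complexConj L))
        (Matrix.GeneralLinearGroup.map (mixedEmbedding L) P) (archFormOf L N H) := by
  have hP : ((Matrix.GeneralLinearGroup.map (mixedEmbedding L) P : GL (Fin N) (mixedSpace L)) : Matrix (Fin N) (Fin N) (mixedSpace L)) =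
      (P : Matrix (Fin N) (Fin N) L).map (mixedEmbedding L) := rfl
  have hfun : (⇑(mixedEmbedding L) ∘ ⇑(cmConjRingHom L)) = (⇑(conjMixed (↥(maximalRealSubfield L)) L (IsCMField.complexConj L)) ∘ ⇑(mixedEmbedding L)) := by
    funext x
    exact (conjMixed_mixedEmbedding (↥(maximalRealSubfield L)) L (IsCMField.complexConj L) x).symm
  rw [archFormOf, archFormOf, formCongr, formCongr, hP, Matrix.map_mul, Matrix.map_mul, Matrix.transpose_map, Matrix.map_map, Matrix.map_map, hfun]

/-- **THE ARCH CONGRUENCE ISO `U(c(P)ᵀ H P)(L⁺ ⊗ ℝ) ≃ₜ* U(H)(L⁺ ⊗ ℝ)`** is ★ `unitaryGroupOfFormCongrOfEq` at `(conjMixed, P ⊗ 1, archFormOf H, archFormOf (c(P)ᵀ H P))`;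
this lemma records its action on elements, `g ↦ (P ⊗ 1) g (P ⊗ 1)⁻¹`, so that consumers can name it without a new definition.
[cite: PlatonovRapinchuk1994, §2.3] [cite: BorelJacquet1979, §4.1] -/
theorem coe_archCongr_apply (P : GL (Fin N) L) (H : Matrix (Fin N) (Fin N) L)
    (g : arch (↥(maximalRealSubfield L)) L (IsCMField.complexConj L) N (formCongr (cmConjRingHom L) P H)) :
    ((unitaryGroupOfFormCongrOfEq (conjMixed (↥(maximalRealSubfield L)) L (IsCMField.complexConj L))
          (Matrix.GeneralLinearGroup.map (mixedEmbedding L) P) (archFormOf L N H) _ (archFormOf_formCongr L P H).symm g :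
        arch (↥(maximalRealSubfield L)) L (IsCMField.complexConj L) N H) : GL (Fin N) (mixedSpace L)) =
      Matrix.GeneralLinearGroup.map (mixedEmbedding L) P * (g : GL (Fin N) (mixedSpace L)) *
        (Matrix.GeneralLinearGroup.map (mixedEmbedding L) P)⁻¹ :=
  rfl

/-- The inverse direction: `g ↦ (P ⊗ 1)⁻¹ g (P ⊗ 1)`. [cite: PlatonovRapinchuk1994, §2.3] -/
theorem coe_archCongr_symm_apply (P : GL (Fin N) L) (H : Matrix (Fin N) (Fin N) L)
    (g : arch (↥(maximalRealSubfield L)) L (IsCMField.complexConj L) N H) :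
    (((unitaryGroupOfFormCongrOfEq (conjMixed (↥(maximalRealSubfield L)) L (IsCMField.complexConj L))
          (Matrix.GeneralLinearGroup.map (mixedEmbedding L) P) (archFormOf L N H) _ (archFormOf_formCongr L P H).symm).symm g :
        arch (↥(maximalRealSubfield L)) L (IsCMField.complexConj L) N (formCongr (cmConjRingHom L) P H)) : GL (Fin N) (mixedSpace L)) =
      (Matrix.GeneralLinearGroup.map (mixedEmbedding L) P)⁻¹ * (g : GL (Fin N) (mixedSpace L)) *
        Matrix.GeneralLinearGroup.map (mixedEmbedding L) P :=
  rfl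

omit [NumberField L] [IsCMField L] in
/-- **RATIONAL POINTS ARE CARRIED TO RATIONAL POINTS**: `(P ⊗ 1) (γ ⊗ 1) (P ⊗ 1)⁻¹ = (P γ P⁻¹) ⊗ 1` (★ `rationalToArch`), so the arch congruence iso restricts to the
congruence of rational unitary groups (★ `unitaryGroupCongr`). [cite: BorelJacquet1979, §4.1] -/
theorem map_mixedEmbedding_conj (P γ : GL (Fin N) L) :
    Matrix.GeneralLinearGroup.map (mixedEmbedding L) P * Matrix.GeneralLinearGroup.map (mixedEmbedding L) γ *
        (Matrix.GeneralLinearGroup.map (mixedEmbedding L) P)⁻¹ =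
      Matrix.GeneralLinearGroup.map (mixedEmbedding L) (P * γ * P⁻¹) := by
  rw [map_mul, map_mul, map_inv]

omit [NumberField L] [IsCMField L] in
/-- **CENTRAL RATIONAL SCALARS ARE FIXED** by the arch congruence conjugation: if `(γ : Matrix) = ζ•1` then `(P ⊗ 1)(γ ⊗ 1)(P ⊗ 1)⁻¹ = γ ⊗ 1` — the `γ₀ = ζ•1`
of the (S-d) central-value clause is the SAME element on both sides of a congruence. [cite: Rogawski1990, §14.5 p. 239] [cite: PlatonovRapinchuk1994, §2.3] -/
theorem map_mixedEmbedding_conj_of_smul_one (P : GL (Fin N) L) {γ : GL (Fin N) L} {ζ : L}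
    (hγ : (γ : Matrix (Fin N) (Fin N) L) = ζ • (1 : Matrix (Fin N) (Fin N) L)) :
    Matrix.GeneralLinearGroup.map (mixedEmbedding L) P * Matrix.GeneralLinearGroup.map (mixedEmbedding L) γ *
        (Matrix.GeneralLinearGroup.map (mixedEmbedding L) P)⁻¹ =
      Matrix.GeneralLinearGroup.map (mixedEmbedding L) γ := by
  rw [map_mixedEmbedding_conj, conj_smul_one_eq P hγ]

/-! ## §3 The guards `hherm`, `hanis`, `hS₀` of the (S-d) letter under congruence -/

/-- `hherm` transports: `c`-hermitian `H` ⇒ `c`-hermitian `c(P)ᵀ H P` (`c` = complex conjugation of the CM field, an involution).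
[cite: Rogawski1990, §14.1 p. 232] [cite: PlatonovRapinchuk1994, §2.3] -/
theorem transpose_map_formCongr_cm (P : GL (Fin N) L) {H : Matrix (Fin N) (Fin N) L} (hH : (H.map (cmConjRingHom L))ᵀ = H) :
    ((formCongr (cmConjRingHom L) P H).map (cmConjRingHom L))ᵀ = formCongr (cmConjRingHom L) P H :=
  transpose_map_formCongr _ (fun x => IsCMField.complexConj_apply_apply L x) P hH

/-- `hanis` transports: anisotropic `H` ⇒ anisotropic `c(P)ᵀ H P`. [cite: Rogawski1990, §14.1 p. 232] [cite: PlatonovRapinchuk1994, §2.3] -/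
theorem anisotropic_formCongr_cm (P : GL (Fin N) L) {H : Matrix (Fin N) (Fin N) L}
    (hH : ∀ x : Fin N → L, hermForm (cmConjRingHom L) H x x = 0 → x = 0) :
    ∀ x : Fin N → L, hermForm (cmConjRingHom L) (formCongr (cmConjRingHom L) P H) x x = 0 → x = 0 :=
  anisotropic_formCongr _ P hH

/-- At a complex embedding `τ`, `τ(c(P)ᵀ H P) = (τ P)ᴴ (τ H) (τ P)` (`τ ∘ c = conj ∘ τ`, ★ `embedding_cmConjRingHom`). [cite: Rogawski1990, §14.1 p. 232] -/
theorem map_embedding_formCongr_cm (τ : L →+* ℂ) (P : GL (Fin N) L) (H : Matrix (Fin N) (Fin N) L) :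
    (formCongr (cmConjRingHom L) P H).map τ =
      ((P : Matrix (Fin N) (Fin N) L).map τ)ᴴ * H.map τ * (P : Matrix (Fin N) (Fin N) L).map τ := by
  have hfun : (⇑τ ∘ ⇑(cmConjRingHom L)) = (star ∘ ⇑τ) := funext fun x => embedding_cmConjRingHom L τ x
  rw [formCongr, Matrix.map_mul, Matrix.map_mul, Matrix.transpose_map, Matrix.map_map, hfun, Matrix.conjTranspose, Matrix.transpose_map,
    Matrix.map_map]

/-- `hS₀` transports: if `τ H` is positive (resp. negative) definite at a complex embedding `τ`, so is `τ(c(P)ᵀ H P)` (Mathlib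
`Matrix.PosDef.conjTranspose_mul_mul_same`, `τ P` invertible). [cite: Rogawski1990, §14.1 p. 232] [cite: PlatonovRapinchuk1994, §2.3] -/
theorem posDef_map_formCongr_cm (τ : L →+* ℂ) (P : GL (Fin N) L) {H : Matrix (Fin N) (Fin N) L}
    (hH : (H.map τ).PosDef ∨ (-H.map τ).PosDef) :
    ((formCongr (cmConjRingHom L) P H).map τ).PosDef ∨ (-(formCongr (cmConjRingHom L) P H).map τ).PosDef := by
  have hinj : Function.Injective ((P : Matrix (Fin N) (Fin N) L).map τ).mulVec := by
    have hu : IsUnit ((P : Matrix (Fin N) (Fin N) L).map τ) := (Matrix.GeneralLinearGroup.map τ P).isUnit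
    exact Matrix.mulVec_injective_iff_isUnit.mpr hu
  rw [map_embedding_formCongr_cm]
  rcases hH with h | h
  · exact Or.inl (h.conjTranspose_mul_mul_same hinj)
  · refine Or.inr ?_
    have := h.conjTranspose_mul_mul_same hinj
    simpa only [Matrix.mul_neg, Matrix.neg_mul] using this

/-- The definite-place guard `hS₀` of the (S-d) letter transports along a congruence. [cite: Rogawski1990, §14.1 p. 232] -/
theorem exists_posDef_formCongr_cm (P : GL (Fin N) L) {H : Matrix (Fin N) (Fin N) L}
    (hS₀ : ∃ w : {w : InfinitePlace L // IsComplex w}, (H.map w.1.embedding).PosDef ∨ (-H.map w.1.embedding).PosDef) :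
    ∃ w : {w : InfinitePlace L // IsComplex w},
      ((formCongr (cmConjRingHom L) P H).map w.1.embedding).PosDef ∨ (-(formCongr (cmConjRingHom L) P H).map w.1.embedding).PosDef := by
  obtain ⟨w, hw⟩ := hS₀
  exact ⟨w, posDef_map_formCongr_cm L w.1.embedding P hw⟩

end CM

end UnitaryGroup

end Literature.NumberTheory.Automorphic
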